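import Mathlib
import Literature.NumberTheory.Transcendental.ZagierDilogarithmConjecture
import Literature.NumberTheory.Transcendental.BlochWignerDilogarithm
import Literature.NumberTheory.Transcendental.BlochWignerDilogarithmProofs
import Literature.NumberTheory.Transcendental.PreBlochRelationCriterion
import Summits.KontsevichZagierPeriods.KontsevichZagierPeriods.Theorems.ZagierDilogarithmConjecture.Negative.DehnInvariant
import Summits.KontsevichZagierPeriods.KontsevichZagierPeriods.Theorems.HyperbolicBlochZagierDilogarithmConjectureDehnRigidity
import Summits.KontsevichZagierPeriods.KontsevichZagierPeriods.Theorems.HyperbolicBlochZagierDilogarithmConjectureStubGaloisDescent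
import Summits.KontsevichZagierPeriods.KontsevichZagierPeriods.Theorems.HyperbolicBlochZagierDilogarithmConjectureStubCyclotomicIndependence
import Summits.KontsevichZagierPeriods.KontsevichZagierPeriods.Theorems.HyperbolicBlochZagierDilogarithmConjectureStubCyclotomicPrimeSectorIff
import HarnessLib

/-!
# `ZagierDilogarithmConjecture` (stmt-KontsevichZagierPeriods-10550) — line `kummer-clausen-linearisation`
(reshape c5, "the cyclotomic tower and the abelian sector"), stub `stub_abelianSector_iff`

**The Dehn-zero sector of Zagier's conjecture over `ℚ(ζ_N)` is EQUIVALENT to Milnor's conjecture at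
level `N` — given Dupont's criterion and abelian propagation.** Notation: `ζ = ζ_N = e^{2πi/N}`, `D` the
Bloch–Wigner dilogarithm (`blochWignerDilog`), `R̄ = ⟨dilogRelators⟩` the relator group of Zagier's
dilogarithm conjecture (Neumann 1998, §2.1), `dehn u v : ℤ[ℂ] → ℚ` the Dehn-type invariants of
`Negative/DehnInvariant` (anti-symmetrised Bloch symbol paired with two `ℚ`-characters of `ℂˣ`).

* *Dehn-zero sector over `ℚ(ζ_N)`*: every `ℤ`-relation `Σ nᵢ D(zᵢ) = 0` among cyclotomic points
  `zᵢ = Σₘ qᵢₘ ζᵐ ∈ ℍ⁺` (`qᵢₘ ∈ ℚ`) whose formal combination `Σ nᵢ[zᵢ]` has all Dehn invariants zero is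
  explained: `Σ nᵢ[zᵢ] ∈ R̄`.
* *Milnor_N* (`ℤ`-form): the Clausen values `D(ζ^c)`, `(c, N) = 1`, `0 < c < N/2`, admit only the
  trivial `ℤ`-relation.

GIVEN (1) Dupont's criterion `Dupont2001_preBloch_relation_of_invariants` (Dupont 2001, Thm. 10.24 a), a
named printed fact, carried as an explicit hypothesis and only handed to `stub_galoisDescent`) and
(2) ABELIAN PROPAGATION (for every level: Milnor_N ⇒ every Dehn-zero relation among cyclotomic points of
`ℍ⁺` propagates to all Galois twists — the lead's `stub_abelianPropagation`, here an antecedent), the two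
are equivalent for every `N ≥ 1`.

Proof. `⇐`: a cyclotomic `ℚ`-combination is algebraic (`ζ` is a root of `X^N − 1`), so propagation (2)
feeds the Galois-descent engine `stub_galoisDescent` (mod Dupont). `⇒`: given `m : ℤ/N → ℤ` supported on
primitive residues `0 < c < N/2` with `Σ_c m_c D(ζ^c) = 0`, index the support `S ≃ Fin k` and present
`ζ^c = Σ_j [j = c] ζ^j` as a cyclotomic combination; `ζ^c ∈ ℍ⁺` (`zeta_pow_im_pos`), and roots of unity
carry no Dehn invariant (`dehn_sum_eq_zero_of_pow_eq_one`: `ℚ`-characters kill torsion). The sector puts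
`Σ_c m_c[ζ^c]` in `R̄`, and the UNCONDITIONAL cyclotomic independence `stub_cyclotomicIndependence`
forces `m = 0`. Sorry-free; axioms ⊆ {propext, Classical.choice, Quot.sound}; conditional only on the
two explicit antecedents.

## References

* W. D. Neumann, *Hilbert's 3rd problem and invariants of 3-manifolds*, Geom. Topol. Monogr. 1 (1998),
  §2.1. [Neumann1998]
* J. Milnor, *Hyperbolic geometry: the first 150 years*, Bull. AMS 6 (1982), Appendix. [Milnor1982]
* J. L. Dupont, *Scissors congruences, group homology and characteristic classes*, World Scientific
  (2001), Thm. 10.24 a). [Dupont2001]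
-/

noncomputable section

open scoped BigOperators ComplexConjugate
open Literature.NumberTheory.Transcendental
open Summit.KontsevichZagierPeriods.HyperbolicBloch.ZagierDilogarithmConjectureNegative (dehn)
open Summit.KontsevichZagierPeriods.HyperbolicBloch.ZagierDilogarithmGaloisDescent (stub_galoisDescent)
open Summit.KontsevichZagierPeriods.HyperbolicBloch.ZagierDilogarithm (dehn_sum_eq_zero_of_pow_eq_one)

namespace Summit.KontsevichZagierPeriods.HyperbolicBloch.ZagierDilogarithmCyclotomic

open CyclotomicPrimeSector (zeta_pow_im_pos)

/-! ### Cyclotomic combinations -/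

namespace AbelianSector

/-- A cyclotomic `ℚ`-combination `Σₘ qₘ ζ_Nᵐ` is algebraic over `ℚ` (`ζ_N` is a root of `X^N − 1`).
[folklore] -/
theorem isAlgebraic_cyclotomicSum (N : ℕ) [NeZero N] (q : Fin N → ℚ) :
    IsAlgebraic ℚ (∑ m : Fin N, (q m : ℂ) * Complex.exp (2 * Real.pi * Complex.I / N) ^ (m : ℕ)) := by
  have hζ : IsAlgebraic ℚ (Complex.exp (2 * Real.pi * Complex.I / N)) := by
    refine ⟨Polynomial.X ^ N - 1, Polynomial.X_pow_sub_C_ne_zero (NeZero.pos N) 1, ?_⟩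
    have h1 : Complex.exp (2 * Real.pi * Complex.I / N) ^ N = 1 :=
      (Complex.isPrimitiveRoot_exp N (NeZero.ne N)).pow_eq_one
    simp [h1]
  exact Finset.sum_induction _ (fun x => IsAlgebraic ℚ x) (fun _ _ => IsAlgebraic.add)
    isAlgebraic_zero (fun m _ => (isAlgebraic_algebraMap (q m : ℚ)).mul (hζ.pow _))

/-- `ζ_N^c = Σ_j [j = c] ζ_N^j`: a power of `ζ_N` (`c mod N`) is the cyclotomic `ℚ`-combination with
indicator coefficients. [folklore] -/
theorem zeta_pow_val_eq_cyclotomicSum (N : ℕ) [NeZero N] (c : ZMod N) :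
    Complex.exp (2 * Real.pi * Complex.I / N) ^ c.val =
      ∑ j : Fin N, ((if j = ⟨c.val, ZMod.val_lt c⟩ then (1 : ℚ) else 0 : ℚ) : ℂ) *
        Complex.exp (2 * Real.pi * Complex.I / N) ^ (j : ℕ) := by
  simp only [apply_ite (Rat.cast : ℚ → ℂ), Rat.cast_one, Rat.cast_zero, ite_mul, one_mul, zero_mul,
    Finset.sum_ite_eq', Finset.mem_univ, if_true]

end AbelianSector

open AbelianSector

/-! ### The equivalence -/

/-- **Stub `stub_abelianSector_iff`: the Dehn-zero sector of Zagier's conjecture over `ℚ(ζ_N)` is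
EQUIVALENT to Milnor's conjecture at level `N`**, given Dupont's criterion (Dupont 2001, Thm. 10.24 a))
and abelian propagation (Milnor_N ⇒ every Dehn-zero relation among cyclotomic points of `ℍ⁺` propagates
to all Galois twists). `⇐`: propagation feeds `stub_galoisDescent` (cyclotomic combinations are
algebraic). `⇒`: roots of unity `ζ_N^c`, `(c, N) = 1`, `0 < c < N/2`, are cyclotomic points of `ℍ⁺` with
zero Dehn invariant (torsion symbols), so an explained primitive combination vanishes by the
unconditional `stub_cyclotomicIndependence`. [cite: Milnor1982, Appendix] -/
theorem stub_abelianSector_iff :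
    Dupont2001_preBloch_relation_of_invariants →
    (∀ (N : ℕ) [NeZero N],
      (∀ m : ZMod N → ℤ, (∀ c, m c ≠ 0 → IsUnit c ∧ 0 < c.val ∧ 2 * c.val < N) →
          ∑ c : ZMod N, (m c : ℝ) *
              blochWignerDilog (Complex.exp (2 * Real.pi * Complex.I / N) ^ c.val) = 0 →
            ∀ c, m c = 0) →
      ∀ (k : ℕ) (z : Fin k → ℂ) (n : Fin k → ℤ) (q : Fin k → Fin N → ℚ),
        (∀ i, z i = ∑ m : Fin N, (q i m : ℂ) * Complex.exp (2 * Real.pi * Complex.I / N) ^ (m : ℕ)) →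
        (∀ i, 0 < (z i).im) →
        (∀ u v : Additive ℂˣ →+ ℚ, dehn u v (∑ i, n i • FreeAbelianGroup.of (z i)) = 0) →
        ∑ i, (n i : ℝ) * blochWignerDilog (z i) = 0 →
          ∀ (σ : ↥(algebraicClosure ℚ ℂ) →ₐ[ℚ] ℂ) (w w' : Fin k → ↥(algebraicClosure ℚ ℂ)),
            (∀ i, (w i : ℂ) = z i) → (∀ i, (w' i : ℂ) = conj (z i)) →
            ∑ i, (n i : ℝ) * (blochWignerDilog (σ (w i)) - blochWignerDilog (σ (w' i))) = 0) →
    ∀ (N : ℕ) [NeZero N],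
      (∀ (k : ℕ) (z : Fin k → ℂ) (n : Fin k → ℤ) (q : Fin k → Fin N → ℚ),
          (∀ i, z i = ∑ m : Fin N, (q i m : ℂ) * Complex.exp (2 * Real.pi * Complex.I / N) ^ (m : ℕ)) →
          (∀ i, 0 < (z i).im) →
          (∀ u v : Additive ℂˣ →+ ℚ, dehn u v (∑ i, n i • FreeAbelianGroup.of (z i)) = 0) →
          ∑ i, (n i : ℝ) * blochWignerDilog (z i) = 0 →
            (∑ i, n i • FreeAbelianGroup.of (z i)) ∈ AddSubgroup.closure dilogRelators) ↔
        (∀ m : ZMod N → ℤ, (∀ c, m c ≠ 0 → IsUnit c ∧ 0 < c.val ∧ 2 * c.val < N) →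
          ∑ c : ZMod N, (m c : ℝ) *
              blochWignerDilog (Complex.exp (2 * Real.pi * Complex.I / N) ^ c.val) = 0 →
            ∀ c, m c = 0) := by
  intro hD hP N _
  classical
  constructor
  · -- `⇒`: restrict the sector to the support family of roots of unity, then cyclotomic independence
    intro hSec m hsupp hsum
    set ζ : ℂ := Complex.exp (2 * Real.pi * Complex.I / N) with hζ
    have hprim : IsPrimitiveRoot ζ N := Complex.isPrimitiveRoot_exp N (NeZero.ne N)
    set S := {c : ZMod N // m c ≠ 0} with hS
    set k := Fintype.card S
    set e : S ≃ Fin k := Fintype.equivFin S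
    set z : Fin k → ℂ := fun i => ζ ^ ((e.symm i : ZMod N)).val with hz
    set n : Fin k → ℤ := fun i => m (e.symm i) with hn
    set q : Fin k → Fin N → ℚ := fun i j =>
      if j = ⟨((e.symm i : ZMod N)).val, ZMod.val_lt _⟩ then 1 else 0 with hq
    have hzq : ∀ i, z i = ∑ j : Fin N, (q i j : ℂ) * ζ ^ (j : ℕ) := fun i =>
      zeta_pow_val_eq_cyclotomicSum N _
    have hpow : ∀ i, z i ^ N = 1 := fun i => by
      simp only [hz]
      rw [← pow_mul, mul_comm, pow_mul, hprim.pow_eq_one, one_pow]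
    have him : ∀ i, 0 < (z i).im := fun i =>
      zeta_pow_im_pos N (hsupp _ (e.symm i).2).2.1 (hsupp _ (e.symm i).2).2.2
    have hdehn : ∀ u v : Additive ℂˣ →+ ℚ, dehn u v (∑ i, n i • FreeAbelianGroup.of (z i)) = 0 :=
      fun u v => dehn_sum_eq_zero_of_pow_eq_one z n (fun i => ⟨N, NeZero.ne N, hpow i⟩) u v
    -- sums over the support family are sums over `ℤ/N`
    have hreindex : ∀ (G : Type) [AddCommMonoid G] (F : ZMod N → ℤ → G), (∀ c, F c 0 = 0) →
        ∑ i, F (e.symm i) (n i) = ∑ c : ZMod N, F c (m c) := by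
      intro G _ F hF
      rw [Fintype.sum_equiv e.symm (fun i => F (e.symm i) (n i)) (fun s : S => F s (m s))
          (fun i => rfl),
        ← Finset.sum_subtype (Finset.univ.filter fun c => m c ≠ 0) (by simp)
          (fun c => F c (m c))]
      exact Finset.sum_filter_of_ne fun c _ hc h0 => hc (by rw [h0, hF])
    have hval : ∑ i, (n i : ℝ) * blochWignerDilog (z i) = 0 := by
      have := hreindex ℝ (fun c t => (t : ℝ) * blochWignerDilog (ζ ^ c.val)) (fun c => by simp)
      rw [this]
      exact hsum
    have hmem := hSec k z n q hzq him hdehn hval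
    have hformal : (∑ i, n i • FreeAbelianGroup.of (z i)) =
        ∑ c : ZMod N, m c • FreeAbelianGroup.of (ζ ^ c.val) :=
      hreindex (FreeAbelianGroup ℂ) (fun c t => t • FreeAbelianGroup.of (ζ ^ c.val))
        (fun c => by simp)
    rw [hformal] at hmem
    exact stub_cyclotomicIndependence N m hsupp hmem
  · -- `⇐`: cyclotomic combinations are algebraic; propagation feeds the Galois descent
    intro hMil k z n q hz him hdehn hsum
    have halg : ∀ i, IsAlgebraic ℚ (z i) := fun i => by
      rw [hz i]
      exact isAlgebraic_cyclotomicSum N (q i)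
    exact stub_galoisDescent hD k z n halg him hdehn (hP N hMil k z n q hz him hdehn hsum)

end Summit.KontsevichZagierPeriods.HyperbolicBloch.ZagierDilogarithmCyclotomic

end
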